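import Summits.CriticalPhenomena.Ising3DConformalLimit.Theorems.HyperoctahedralRPExistsScaleCovariantLimitDecimationDefs
import HarnessLib

/-!
# The endpoint identity of line `decimation-homotopy-rate` (crux `ExistsScaleCovariantLimit`, stmt-CriticalPhenomena-1981)

Route `HyperoctahedralRP` (sub-problem `CriticalPhenomena/Ising3DConformalLimit`), crux
`Summit.CriticalPhenomena.Ising3DConformalLimit.Theses.HyperoctahedralRP.ExistsScaleCovariantLimit`, line
`decimation-homotopy-rate` (lead `prover-line-stmt-CriticalPhenomena-1981-c8-0`, skeleton v2), registered stub E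
`stub_endpointIdentity : Sig.stub_endpointIdentity` (vocabulary in the definitions module
`HyperoctahedralRPExistsScaleCovariantLimitDecimationDefs`).

**Statement.** For every period `p ≥ 2`, every volume `N`, coupling `J` and integer configuration `x`,
`boxAvg p N 0 J (p • x) = PairIsing.gibbsAvg (nnCoupling ⌊N/p⌋ J) (boxMonomial ⌊N/p⌋ x)`: at the `K = 0` end of the
two-coupling family the sublattice spins `pℤ³ ∩ Λ_N` ARE the nearest-neighbour model at coupling `J` on the box
`Λ_{⌊N/p⌋}` and every other spin is a free coin. Exact finite-volume identity.

**Proof.** At `K = 0` the coupling matrix `decimationCoupling p N 0 J a b` vanishes unless both `a` and `b` lie on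
`pℤ³` (`coupling_off_sub`). (i) MARGINALISATION (`gibbsAvg_restrict`, a general lemma on `PairIsing.gibbsAvg` over a
finite index set `ι` and a predicate `P`): if the couplings vanish off `P × P` and the observable factors through the
restriction `σ ↦ σ|_P`, then the Boltzmann weight factors through it too (`gibbsWeight_restrict`), the configuration
space splits as `(P → ℤˣ) × (¬P → ℤˣ)` (`Equiv.piEquivPiSubtypeProd`), and the `|¬P → ℤˣ|` free spins cancel between
numerator and denominator. (ii) TRANSPORT: `y ↦ p • y` is a bijection `Λ_{⌊N/p⌋} ≃ Λ_N ∩ pℤ³` (`exists_subEquiv`;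
`p • y ∈ Λ_N ↔ y ∈ Λ_{⌊N/p⌋}`, `smul_mem_box`), under which the restricted couplings are `nnCoupling ⌊N/p⌋ J`
(`coupling_transport`: `p • w` is never a nearest-neighbour step for `p ≥ 2`, and `IsAxisStep p (p • w) ↔ IsNN w`) and
the observable is `boxMonomial ⌊N/p⌋ x` (`monomial_transport`); `PairIsing.gibbsAvg_comp_equiv` relabels.

References: L. P. Kadanoff, Physics 2 (1966) 263 (decimation / bond moving); S. Friedli, Y. Velenik, *Statistical
Mechanics of Lattice Systems* (CUP 2017) §3.1 (finite-volume Gibbs averages). Elementary; no definitions, no named-fact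
hypotheses, no `sorry`.
-/

noncomputable section

namespace Summit.CriticalPhenomena.Ising3DConformalLimit.Cruxes.ExistsScaleCovariantLimit.DecimationHomotopyRate

open Literature.Probability.LatticeModels
open scoped BigOperators
open Classical

/-! ## §1 Marginalisation of free spins in `PairIsing.gibbsAvg` -/

namespace EndpointIdentityProof

section Marginal

variable {ι : Type*} [Fintype ι] (P : ι → Prop) [DecidablePred P]

/-- A double sum whose terms vanish off `P × P` is the double sum over the subtype of `P`. [folklore] -/
theorem sum_sum_subtype (F : ι → ι → ℝ) (hF : ∀ a b, ¬ (P a ∧ P b) → F a b = 0) :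
    ∑ a, ∑ b, F a b = ∑ a : {a // P a}, ∑ b : {b // P b}, F a.1 b.1 := by
  rw [← Fintype.sum_subtype_add_sum_subtype P]
  have h2 : ∑ a : {a // ¬ P a}, ∑ b, F a.1 b = 0 :=
    Finset.sum_eq_zero fun a _ => Finset.sum_eq_zero fun b _ => hF _ _ fun h => a.2 h.1
  rw [h2, add_zero]
  refine Finset.sum_congr rfl fun a _ => ?_
  rw [← Fintype.sum_subtype_add_sum_subtype P]
  have h3 : ∑ b : {b // ¬ P b}, F a.1 b.1 = 0 :=
    Finset.sum_eq_zero fun b _ => hF _ _ fun h => b.2 h.2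
  rw [h3, add_zero]

/-- If the couplings vanish off `P × P`, the Boltzmann weight depends only on the restriction of the
configuration to `P`, and is the weight of the restricted couplings there. [folklore] -/
theorem gibbsWeight_restrict (c : ι → ι → ℝ) (hc : ∀ a b, ¬ (P a ∧ P b) → c a b = 0) (σ : SpinConfig ι) :
    PairIsing.gibbsWeight c σ =
      PairIsing.gibbsWeight (fun a b : {a // P a} => c a.1 b.1) (fun a => σ a.1) := by
  unfold PairIsing.gibbsWeight
  rw [sum_sum_subtype P (fun a b => c a b * (spinAt a σ * spinAt b σ))
      (fun a b h => by rw [hc a b h, zero_mul])]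
  rfl

/-- Summing a function of the restriction `σ|_P` over all configurations: the free spins off `P` contribute
the constant factor `|{a // ¬P a} → ℤˣ|`. [folklore] -/
theorem sum_restrict [DecidableEq ι] (F : SpinConfig ι → ℝ) (G : SpinConfig {a // P a} → ℝ)
    (hFG : ∀ σ, F σ = G (fun a => σ a.1)) :
    ∑ σ, F σ = (Fintype.card ({a // ¬ P a} → ℤˣ) : ℝ) * ∑ τ, G τ := by
  rw [Fintype.sum_equiv (Equiv.piEquivPiSubtypeProd P (fun _ : ι => ℤˣ)) F (fun q => G q.1) hFG,
    Fintype.sum_prod_type, Finset.mul_sum]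
  refine Finset.sum_congr rfl fun τ _ => ?_
  dsimp only
  rw [Finset.sum_const, Finset.card_univ, nsmul_eq_mul]

/-- **Marginalisation of free spins.** If the couplings vanish off `P × P` and the observable factors through
the restriction to `P`, the Gibbs average is the Gibbs average of the restricted model on `{a // P a}`: the
spins off `P` are independent fair coins and integrate out of numerator and denominator. [folklore] -/
theorem gibbsAvg_restrict [DecidableEq ι] (c : ι → ι → ℝ) (hc : ∀ a b, ¬ (P a ∧ P b) → c a b = 0)
    (f : SpinConfig ι → ℝ) (g : SpinConfig {a // P a} → ℝ) (hfg : ∀ σ, f σ = g (fun a => σ a.1)) :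
    PairIsing.gibbsAvg c f = PairIsing.gibbsAvg (fun a b : {a // P a} => c a.1 b.1) g := by
  have hK : (Fintype.card ({a // ¬ P a} → ℤˣ) : ℝ) ≠ 0 := Nat.cast_ne_zero.2 Fintype.card_ne_zero
  rw [PairIsing.gibbsAvg_def, PairIsing.gibbsAvg_def,
    sum_restrict P (fun σ => f σ * PairIsing.gibbsWeight c σ)
      (fun τ => g τ * PairIsing.gibbsWeight (fun a b : {a // P a} => c a.1 b.1) τ)
      (fun σ => by rw [hfg σ, gibbsWeight_restrict P c hc σ]),
    sum_restrict P (fun σ => PairIsing.gibbsWeight c σ)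
      (fun τ => PairIsing.gibbsWeight (fun a b : {a // P a} => c a.1 b.1) τ)
      (fun σ => gibbsWeight_restrict P c hc σ),
    mul_div_mul_left _ _ hK]

end Marginal

/-! ## §2 Geometry of the sublattice `pℤ³` inside the box `Λ_N` -/

/-- `2 ≤ p → 0 < p`. [folklore] -/
theorem pos_of_two_le {p : ℕ} (hp : 2 ≤ p) : 0 < p := by omega

/-- `p • y ∈ Λ_N ↔ y ∈ Λ_{⌊N/p⌋}` for `p ≥ 1` (coordinatewise `-N ≤ p yᵢ ≤ N ↔ -⌊N/p⌋ ≤ yᵢ ≤ ⌊N/p⌋`). [folklore] -/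
theorem smul_mem_box {p : ℕ} (hp : 0 < p) (N : ℕ) (y : Site 3) :
    (p : ℤ) • y ∈ box 3 N ↔ y ∈ box 3 (N / p) := by
  have hp' : (0 : ℤ) < p := by exact_mod_cast hp
  simp only [mem_box, Pi.smul_apply, smul_eq_mul, Int.natCast_ediv]
  refine forall_congr' fun i => ?_
  have h1 : y i ≤ (N : ℤ) / p ↔ y i * p ≤ N := Int.le_ediv_iff_mul_le hp'
  have h2 : -y i ≤ (N : ℤ) / p ↔ -y i * p ≤ N := Int.le_ediv_iff_mul_le hp'
  constructor
  · rintro ⟨hl, hu⟩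
    refine ⟨?_, h1.2 (by linarith)⟩
    have := h2.2 (by linarith)
    linarith
  · rintro ⟨hl, hu⟩
    refine ⟨?_, ?_⟩
    · have := h2.1 (by linarith)
      linarith
    · have := h1.1 hu
      linarith

/-- `p • y` lies on the sublattice `pℤ³`. [folklore] -/
theorem onSub_smul (p : ℕ) (y : Site 3) : OnSub p ((p : ℤ) • y) :=
  fun i => ⟨y i, by rw [Pi.smul_apply, smul_eq_mul]⟩

/-- A sublattice site is `p` times its coordinatewise quotient. [folklore] -/
theorem smul_ediv_of_onSub {p : ℕ} {v : Site 3} (hv : OnSub p v) :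
    (p : ℤ) • (fun i => v i / (p : ℤ)) = v := by
  funext i
  rw [Pi.smul_apply, smul_eq_mul]
  exact Int.mul_ediv_cancel' (hv i)

/-- `(p • u = p • v) ↔ u = v` on `ℤ³` for `p ≥ 1`. [folklore] -/
theorem smul_cancel_iff {p : ℕ} (hp : 0 < p) (u v : Site 3) : (p : ℤ) • u = (p : ℤ) • v ↔ u = v := by
  refine ⟨fun h => funext fun i => ?_, fun h => by rw [h]⟩
  have hi := congr_fun h i
  rw [Pi.smul_apply, Pi.smul_apply, smul_eq_mul, smul_eq_mul] at hi
  exact Int.eq_of_mul_eq_mul_left (by exact_mod_cast hp.ne') hi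

/-- For `p ≥ 2` a multiple `p • w` is never a nearest-neighbour step (a coordinate would be a unit divisible
by `p`). [folklore] -/
theorem not_isNN_smul {p : ℕ} (hp : 2 ≤ p) (w : Site 3) : ¬ IsNN ((p : ℤ) • w) := by
  rintro ⟨i, h⟩
  have hdvd : (p : ℤ) ∣ ((p : ℤ) • w) i := ⟨w i, by rw [Pi.smul_apply, smul_eq_mul]⟩
  have h1 : (p : ℤ) ∣ 1 := by
    rcases h with h | h
    · rw [h, Pi.single_eq_same] at hdvd
      exact hdvd
    · rw [h, Pi.neg_apply, Pi.single_eq_same] at hdvd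
      exact dvd_neg.1 hdvd
  have h2 := Int.eq_one_of_dvd_one (Int.natCast_nonneg p) h1
  omega

/-- `p • w` is a range-`p` axis step iff `w` is a nearest-neighbour step (`p ≥ 1`). [folklore] -/
theorem isAxisStep_smul_iff {p : ℕ} (hp : 0 < p) (w : Site 3) :
    IsAxisStep p ((p : ℤ) • w) ↔ IsNN w := by
  have hsingle : ∀ i : Fin 3, (Pi.single i (p : ℤ) : Site 3) = (p : ℤ) • (Pi.single i (1 : ℤ) : Site 3) :=
    fun i => by rw [← Pi.single_smul', smul_eq_mul, mul_one]
  unfold IsAxisStep IsNN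
  refine exists_congr fun i => ?_
  rw [hsingle, ← smul_neg, smul_cancel_iff hp, smul_cancel_iff hp]

/-- **The sublattice sites of `Λ_N` are `p • Λ_{⌊N/p⌋}`**: `y ↦ p • y` is a bijection from the box `Λ_{⌊N/p⌋}`
onto `{a ∈ Λ_N | a ∈ pℤ³}` (inverse: coordinatewise quotient by `p`). Stated as the existence of an `Equiv` whose
forward map is `y ↦ p • y`. [folklore] -/
theorem exists_subEquiv {p : ℕ} (hp : 0 < p) (N : ℕ) :
    ∃ e : ↥(box 3 (N / p)) ≃ {a : ↥(box 3 N) // OnSub p a.1}, ∀ y, (e y).1.1 = (p : ℤ) • y.1 :=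
  ⟨{ toFun := fun y => ⟨⟨(p : ℤ) • y.1, (smul_mem_box hp N y.1).2 y.2⟩, onSub_smul p y.1⟩
     invFun := fun a => ⟨fun i => a.1.1 i / (p : ℤ),
       (smul_mem_box hp N _).1 (by rw [smul_ediv_of_onSub a.2]; exact a.1.2)⟩
     left_inv := fun y => by
       ext i
       show ((p : ℤ) • y.1) i / (p : ℤ) = y.1 i
       rw [Pi.smul_apply, smul_eq_mul]
       exact Int.mul_ediv_cancel_left _ (by exact_mod_cast hp.ne')
     right_inv := fun a => by
       ext i
       show ((p : ℤ) • fun j => a.1.1 j / (p : ℤ)) i = a.1.1 i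
       rw [smul_ediv_of_onSub a.2] }, fun _ => rfl⟩

/-! ## §3 The two pointwise identities under `y ↦ p • y` -/

/-- At `K = 0` the two-coupling matrix vanishes unless both ends lie on the sublattice. [folklore] -/
theorem coupling_off_sub (p N : ℕ) (J : ℝ) (a b : ↥(box 3 N)) (h : ¬ (OnSub p a.1 ∧ OnSub p b.1)) :
    decimationCoupling p N 0 J a b = 0 := by
  simp only [decimationCoupling]
  by_cases h1 : IsNN (b.1 - a.1)
  · rw [if_pos h1, zero_div]
  · rw [if_neg h1, if_neg fun h2 => h ⟨h2.1, h2.2.1⟩]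

/-- Under `y ↦ p • y` the `K = 0` couplings between sublattice sites of `Λ_N` are the nearest-neighbour couplings
`J` of `Λ_{⌊N/p⌋}` (`p ≥ 2`: `p • w` is never a n.n. step, `IsAxisStep p (p • w) ↔ IsNN w`). [folklore] -/
theorem coupling_transport {p : ℕ} (hp : 2 ≤ p) (N : ℕ) (J : ℝ)
    (e : ↥(box 3 (N / p)) ≃ {a : ↥(box 3 N) // OnSub p a.1}) (he : ∀ y, (e y).1.1 = (p : ℤ) • y.1)
    (a b : ↥(box 3 (N / p))) :
    decimationCoupling p N 0 J (e a).1 (e b).1 = nnCoupling (N / p) J a b := by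
  have hp0 : 0 < p := pos_of_two_le hp
  simp only [decimationCoupling, nnCoupling]
  rw [he a, he b, ← smul_sub, if_neg (not_isNN_smul hp _)]
  by_cases h : IsNN (b.1 - a.1)
  · rw [if_pos h, if_pos ⟨onSub_smul p _, onSub_smul p _, (isAxisStep_smul_iff hp0 _).2 h⟩]
  · rw [if_neg h, if_neg fun h' => h ((isAxisStep_smul_iff hp0 _).1 h'.2.2)]

/-- `boxMonomial N (p • x)` factors through the restriction of the configuration to the sublattice. [folklore] -/
theorem boxMonomial_smul_eq (p N : ℕ) {n : ℕ} (x : Fin n → Site 3) (σ : SpinConfig ↥(box 3 N)) :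
    boxMonomial N (fun i => (p : ℤ) • x i) σ =
      ∏ i, if h : (p : ℤ) • x i ∈ box 3 N then
        spinAt (⟨⟨(p : ℤ) • x i, h⟩, onSub_smul p (x i)⟩ : {a : ↥(box 3 N) // OnSub p a.1})
          (fun a : {a : ↥(box 3 N) // OnSub p a.1} => σ a.1) else 1 := rfl

/-- Under `y ↦ p • y` the sublattice observable `∏ᵢ σ_{p xᵢ}` of `Λ_N` is the observable `∏ᵢ σ_{xᵢ}` of
`Λ_{⌊N/p⌋}` (junk-consistently: `p • xᵢ ∈ Λ_N ↔ xᵢ ∈ Λ_{⌊N/p⌋}`). [folklore] -/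
theorem monomial_transport {p : ℕ} (hp : 0 < p) (N : ℕ)
    (e : ↥(box 3 (N / p)) ≃ {a : ↥(box 3 N) // OnSub p a.1}) (he : ∀ y, (e y).1.1 = (p : ℤ) • y.1)
    {n : ℕ} (x : Fin n → Site 3) (s : SpinConfig ↥(box 3 (N / p))) :
    (∏ i, if h : (p : ℤ) • x i ∈ box 3 N then
        spinAt (⟨⟨(p : ℤ) • x i, h⟩, onSub_smul p (x i)⟩ : {a : ↥(box 3 N) // OnSub p a.1}) (s ∘ e.symm)
      else 1) = boxMonomial (N / p) x s := by
  unfold boxMonomial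
  refine Finset.prod_congr rfl fun i _ => ?_
  by_cases hx : x i ∈ box 3 (N / p)
  · have h1 : (p : ℤ) • x i ∈ box 3 N := (smul_mem_box hp N _).2 hx
    have h2 : e.symm ⟨⟨(p : ℤ) • x i, h1⟩, onSub_smul p (x i)⟩ = ⟨x i, hx⟩ :=
      (Equiv.symm_apply_eq _).2 (Subtype.ext (Subtype.ext (he ⟨x i, hx⟩).symm))
    rw [dif_pos h1, dif_pos hx]
    simp only [spinAt, Function.comp_apply, h2]
  · rw [dif_neg (fun h => hx ((smul_mem_box hp N _).1 h)), dif_neg hx]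

end EndpointIdentityProof

/-! ## §4 The registered stub -/

open EndpointIdentityProof in
/-- **Stub E — the ENDPOINT IDENTITY** (`Sig.stub_endpointIdentity`): for every period `p ≥ 2`, volume `N`, coupling
`J` and integer configuration `x`, the `K = 0` two-coupling box average of the sublattice monomial `∏ᵢ σ_{p xᵢ}` in
`Λ_N` equals the free nearest-neighbour box average at coupling `J` of `∏ᵢ σ_{xᵢ}` in `Λ_{⌊N/p⌋}`: the free spins off
`pℤ³` integrate out (`gibbsAvg_restrict`) and `Λ_N ∩ pℤ³ = p • Λ_{⌊N/p⌋}` relabels couplings and observable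
(`exists_subEquiv`, `coupling_transport`, `monomial_transport`, `PairIsing.gibbsAvg_comp_equiv`). [folklore] -/
theorem stub_endpointIdentity : Sig.stub_endpointIdentity := by
  intro p hp N J n x
  have hp0 : 0 < p := pos_of_two_le hp
  obtain ⟨e, he⟩ := exists_subEquiv hp0 N
  rw [boxAvg, gibbsAvg_restrict (fun a : ↥(box 3 N) => OnSub p a.1) (decimationCoupling p N 0 J)
      (fun a b h => coupling_off_sub p N J a b h) (boxMonomial N fun i => (p : ℤ) • x i)
      (fun τ => ∏ i, if h : (p : ℤ) • x i ∈ box 3 N then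
        spinAt (⟨⟨(p : ℤ) • x i, h⟩, onSub_smul p (x i)⟩ : {a : ↥(box 3 N) // OnSub p a.1}) τ else 1)
      (boxMonomial_smul_eq p N x),
    ← PairIsing.gibbsAvg_comp_equiv e]
  congr 1
  · funext a b
    exact coupling_transport hp N J e he a b
  · funext s
    exact monomial_transport hp0 N e he x s

end Summit.CriticalPhenomena.Ising3DConformalLimit.Cruxes.ExistsScaleCovariantLimit.DecimationHomotopyRate

end
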